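import Literature.Computability.MetaComplexity.HeuristicClasses
import Literature.Computability.MetaComplexity.DistProblemsProofs
import Literature.Computability.MetaComplexity.UniversalMachineProofs
import Literature.Computability.Complexity.PlumbingBricks
import Literature.Computability.Complexity.FPStringBricks
import Literature.Computability.Complexity.LengthCompare
import Literature.Computability.Complexity.ClockedUniversalSimulationProofs
import HarnessLib

/-!
# Existence of `DistNP`-complete problems, from a clocked universal machine (proof)

Sibling proof file of `HeuristicClasses.lean` (D-0014: named facts `def X : Prop` are
discharged as `theorem X_holds : X`). Target: the named fact
`Literature.Computability.MetaComplexity.exists_isDistNPComplete` (`∃ Q, IsDistNPComplete Q`: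
some distributional problem of `DistNP = (NP, PSamp)` is hard for `DistNP` under deterministic
heuristic polynomial-time reductions, `DistProblem.PolyTimeReducible`). This file proves it
**from the tree's universal-machine fact**
`Literature.Computability.MetaComplexity.UniversalMachine.clockedUniversalSimulation`
(`UniversalMachineProofs.lean`; Arora–Barak 2009, Thm. 1.9 in the clocked form of §1.4.1,
transported to Mathlib's `Turing.FinTM2`), which is the only ingredient of the printed proof
that is not a theorem of the tree:

* `exists_isDistNPComplete_of_clockedUniversalSimulation :
    UniversalMachine.clockedUniversalSimulation → exists_isDistNPComplete`,
* `exists_isDistNPComplete_of_universalMachine (U : UniversalMachine) : exists_isDistNPComplete`,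
* `exists_isDistNPComplete_holds : exists_isDistNPComplete` — the discharge, the hypothesis being
  now a theorem of the tree (`ClockedUS.clockedUniversalSimulation_holds'`,
  `Complexity/ClockedUniversalSimulationProofs.lean`, whose statement is verbatim the body of
  `UniversalMachine.clockedUniversalSimulation`).

## The printed theorem and its proof

Ben-David, Chor, Goldreich and Luby, *On the theory of average case complexity*, JCSS 44
(1992), §6, Theorem 9 (p. 209): "There exist problems which are complete in
(NP, P-samplable)." Proof (p. 209–210, "following ideas implicit in [Levin 1986]"): enumerate
all (clocked) sampling machines, giving samplable distributions `ν₁, ν₂, …`; the *universal*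
distribution `ν_U` assigns `x` the mass `Σᵢ (1/i²) νᵢ(x)` and is itself samplable ("first select
`i` with probability `1/i²` and next sample `νᵢ`"); the distributional bounded-halting problem
`(BH, ν_U)` is complete: for `(D, μ) ∈ (NP, P-samplable)` with sampler `S`, let `f` be "the
standard Karp reduction of `D` to `BH` (i.e. the reduction which maps an instance `x` of `D` to
a triple `(M, x, 1ᵏ)`, where `M` is an NP machine for `D` and `k` is a bound on the running
time of `M`)"; then "applying `f` to the output of `S` yields a sampling algorithm" which is one
of the enumerated ones, `νⱼ = f(μ)`, so that `ν_U` dominates `f(μ)` with the constant factor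
`j²`. (Levin 1986 proves the `P`-computable version; Bogdanov–Trevisan 2006, Thm. 3.3 and the
introduction of Ch. 5, restate both.)

## The proof here (ensembles, Bogdanov–Trevisan's conventions of `HeuristicClasses.lean`)

Let `run : {0,1}* → ℕ → Option {0,1}*` be the clocked interpreter of the hypothesis (monotone in
the budget; `(prog, t) ↦ run prog t` polynomial-time on `⟨prog, 1ᵗ⟩`; every machine `M` has a
code `e` and an overhead polynomial `p` with `M(w) = y within t steps ⟹ run ⟨e, w⟩ (p t) = y`).

* **The complete language** (`DistNPComplete.Lstar`): `v ∈ L⋆ ↔ ∃ y, |y| ≤ |v| ∧ ⟨v, y⟩ ∈ L'`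
  with `L' = {⟨⟨k, ⟨x, u⟩⟩, y⟩ : |y| ≤ |u| ∧ run ⟨k, ⟨x, y⟩⟩ |u| = some [1]}` — bounded
  nondeterministic acceptance by the coded machine `k`, budget `|u|` in unary. `L' ∈ P` because
  its indicator is an `FP` brick expression around the universal machine
  (`mem_FP_of_unaryArg`, `lenLeFn`, `eqPairFn`, `Brick.andFn`), hence `L⋆ ∈ NP = ∃ᵖ·P` by
  definition.
* **The universal ensemble** (`DistNPComplete.univSampler`): on `1ᴺ` with `N` coins `r`,
  parse the COINS self-delimitingly as `r = ⟨k, ⟨ν, ⟨λ, ρ⟩⟩⟩` (code, binary numerals `ν`, `λ`,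
  rest), let `n = min ⟦ν⟧ N`, `ℓ = min ⟦λ⟧ N` (bounded binary-to-unary conversion
  `binToUnaryFn`), feed the program `⟨k, ⟨1ⁿ, ρ ↾ ℓ⟩⟩` to `run` with budget `N`, and output
  `⟨e', ⟨x', 1ᴺ⟩⟩` where `⟨e', x'⟩` is the result (empty on failure). A coin string of the
  displayed shape has probability `2^{-(2|k| + 2|ν| + 2|λ| + 6)}` and then the `ℓ` coins fed to
  `k` are uniform: this is BCGL's "select `i` with probability `1/i²`, then sample `νᵢ`", with
  the number `n` of the simulated sampler's input `1ⁿ` and its number of coins `ℓ` also drawn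
  at random (polynomial loss `(2n+1)²(2ℓ+1)²`), because in the vendored model the coin budget
  `coinLen n` of a sampler is an arbitrary function bounded by a polynomial and the parameter `N`
  of the universal ensemble can only carry the time budget. The sampler is ONE `FP` function, so
  the ensemble is in `PSamp` by construction.
* **The reduction** of `(L, D) ∈ (NP, PSamp)`: let `L_V ∈ P`, `p_L` present `L`
  (`x ∈ L ↔ ∃ y, |y| ≤ p_L |x| ∧ ⟨x, y⟩ ∈ L_V`), `M_V` a polynomial-time decider of
  `LenLe p_L ∩ L_V` with code `e`; then `f(x; n) = ⟨e, ⟨x, 1^{m(n)}⟩⟩` for a large enough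
  polynomial `m` (BCGL's `(M, x, 1ᵏ)`). *Correctness on `supp Dₙ`* (where `|x| ≤ s(n)`,
  `IsPolySamplable.hasPolyLength_holds`): completeness of `run` and — in place of a soundness
  clause, which `clockedUniversalSimulation` does not state — its monotonicity: the decider is
  total, so on every `⟨x, y⟩` some budget yields its true answer `[b]`, and `run` being a
  function at the larger of the two budgets forces `b = 1` whenever budget `m(n)` accepts.
  *Domination*: the IMAGE sampler `B = (prefix e) ∘ M_A` (`⟨1ⁿ, ρ⟩ ↦ ⟨e, A(1ⁿ, ρ)⟩`, one `TM2`
  machine by `Turing.TM2ComputableAux.comp`) has a code `e_B`; the coin strings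
  `⟨e_B, ⟨bin n, ⟨bin ℓₙ, ρ ρ'⟩⟩⟩` (`ℓₙ = coinLen n`) make the universal sampler at
  `N = m(n)` output exactly `f(A(1ⁿ, ρ); n)`, whence
  `Dₙ{x | f(x; n) = y} ≤ 2^{2|e_B| + 2|bin n| + 2|bin ℓₙ| + 6} · U_{m(n)}(y) ≤ p(n) · U_{m(n)}(y)`
  with `p = 2^{2|e_B|+6} (2X+1)² (2q_A+1)²` (`DistNPComplete.map_apply_le_of_prefix`, a counting
  injection `(ρ, pad) ↦ pre ρ pad` between uniform coin spaces).

## References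

* S. Ben-David, B. Chor, O. Goldreich, M. Luby, *On the theory of average case complexity*,
  J. Comput. Syst. Sci. 44 (1992) 193–219, §6, Def. 3–4 and Theorem 9 (pp. 207–210).
  doi:10.1016/0022-0000(92)90019-f
* L. A. Levin, *Average case complete problems*, SIAM J. Comput. 15 (1986) 285–286.
  doi:10.1137/0215020
* A. Bogdanov, L. Trevisan, *Average-Case Complexity*, Found. Trends TCS 2 (2006), Thm. 3.3 and
  Ch. 5 (introduction). arXiv:cs/0606037
* S. Arora, B. Barak, *Computational Complexity: A Modern Approach*, CUP 2009, Thm. 1.9 and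
  §1.4.1 (clocked universal machine), §1.3 (closure properties of polynomial time).
-/

namespace Literature.Computability.MetaComplexity

open _root_.Computability Complexity Complexity.Classes Complexity.Nondeterministic Polynomial
open scoped ENNReal

namespace DistNPComplete

/-! ### Small arithmetic and coding facts -/

/-- `|1ⁿ| = n` (`unaryDecodeNat` is `List.length`). [Mathlib `Computability.unary_decode_encode_nat`]
[folklore] -/
private theorem length_unaryEncodeNat (n : ℕ) : (unaryEncodeNat n).length = n :=
  unary_decode_encode_nat n

/-- Mathlib's unary numeral is the block `1ⁿ` (`ones`). [folklore] -/
private theorem unaryEncodeNat_eq_ones (n : ℕ) : unaryEncodeNat n = ones n :=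
  unaryEncodeNat_eq_replicate n

/-- Evaluation of an `ℕ`-polynomial is monotone in the argument. [folklore] -/
private theorem natPoly_eval_mono (p : Polynomial ℕ) {a b : ℕ} (h : a ≤ b) :
    p.eval a ≤ p.eval b := by
  induction p using Polynomial.induction_on' with
  | add p q hp hq => simp only [eval_add]; exact Nat.add_le_add hp hq
  | monomial n c =>
    simp only [eval_monomial]
    exact Nat.mul_le_mul_left c (Nat.pow_le_pow_left h n)

/-- `2^{|bin k|} ≤ 2k + 1`: the binary numeral of `k` has `size k` digits. [folklore] -/
private theorem two_pow_length_encodeNat_le (k : ℕ) : 2 ^ (encodeNat k).length ≤ 2 * k + 1 := by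
  rw [TM2Pass.length_encodeNat_eq_size]
  rcases Nat.eq_zero_or_pos k with rfl | hk
  · simp
  · have hs : 0 < k.size := Nat.size_pos.2 hk
    have h1 : 2 ^ (k.size - 1) ≤ k := Nat.lt_size.1 (Nat.sub_lt hs Nat.one_pos)
    have h2 : 2 ^ k.size = 2 * 2 ^ (k.size - 1) := by
      rw [← pow_succ']; congr 1; omega
    omega

/-- `|bin k| ≤ 2k`. [folklore] -/
private theorem length_encodeNat_le_two_mul (k : ℕ) : (encodeNat k).length ≤ 2 * k := by
  have h1 := two_pow_length_encodeNat_le k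
  have h2 := Nat.lt_two_pow_self (n := (encodeNat k).length)
  omega

/-- `⟨a, b⟩ ++ c = ⟨a, b ++ c⟩`. [folklore] -/
private theorem boolPair_append (a b c : List Bool) : boolPair a b ++ c = boolPair a (b ++ c) := by
  simp [boolPair, List.append_assoc]

/-- The option-of-string encoding of `UniversalMachine.polyTime` (`none ↦ 0`, `some y ↦ 1 y`).
[folklore] -/
abbrev optEnc : Option (List Bool) → List Bool := ((encodingList Bool).optionBool).encode

/-- `optEnc none = [0]`. [folklore] -/
@[simp] theorem optEnc_none : optEnc none = [false] := rfl

/-- `optEnc (some y) = 1 y`. [folklore] -/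
@[simp] theorem optEnc_some (y : List Bool) : optEnc (some y) = true :: y := rfl

/-- Dropping the tag: `(optEnc o).tail = o.getD []`. [folklore] -/
@[simp] theorem tail_optEnc (o : Option (List Bool)) : (optEnc o).tail = o.getD [] := by
  cases o <;> rfl

/-- `optEnc o = [1, 1] ↔ o = some [1]`. [folklore] -/
theorem optEnc_eq_true_true_iff (o : Option (List Bool)) : optEnc o = [true, true] ↔ o = some [true] := by
  cases o with
  | none => simp
  | some y => simp

variable (run : List Bool → ℕ → Option (List Bool))

/-! ### The universal machine as a total `FP` string function -/

/-- `runStr ⟨prog, u⟩ = optEnc (run prog |u|)` (on every word, through the total pair decoder).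
[Arora–Barak 2009, §1.4.1] [folklore] -/
def runStr : List Bool → List Bool := fun w =>
  optEnc (run (boolUnpair w).1 (boolUnpair w).2.length)

/-- `runStr ⟨prog, u⟩ = optEnc (run prog |u|)`. [folklore] -/
@[simp] theorem runStr_boolPair (prog u : List Bool) :
    runStr run (boolPair prog u) = optEnc (run prog u.length) := by
  simp [runStr]

/-- `runStr ∈ FP` when the universal machine is polynomial time on `⟨prog, 1ᵗ⟩`
(`mem_FP_of_unaryArg`). [cite: AroraBarak2009, Thm. 1.9 and §1.4.1] -/
theorem runStr_mem_FP
    (hrun : PolyTimeComputable (fun q : List Bool × ℕ => boolPair q.1 (unaryEncodeNat q.2))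
      optEnc (Function.uncurry run)) :
    runStr run ∈ FP :=
  mem_FP_of_unaryArg hrun

/-! ### The complete language: bounded nondeterministic acceptance -/

/-- The verifier language `L' = {⟨⟨k, ⟨x, u⟩⟩, y⟩ : |y| ≤ |u| ∧ run ⟨k, ⟨x, y⟩⟩ |u| = some [1]}`,
as the set where its `FP` indicator is `[1]`: the indicator is the conjunction (`Brick.andFn`)
of the length test `lenLeFn X ⟨u, y⟩` and the equality test
`eqPairFn ⟨runStr ⟨⟨k, ⟨x, y⟩⟩, u⟩, [1, 1]⟩`. [BCGL 1992, §6 (proof of Thm. 9, the language `BH`)]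
[cite: BendavidEtAl1992, Theorem 9 (proof)] -/
noncomputable def verInd : List Bool → List Bool :=
  Brick.andFn
    (lenLeFn X ∘ fanoutFn (sndP ∘ sndP ∘ fstP) sndP)
    (eqPairFn ∘ fanoutFn
      (runStr run ∘ fanoutFn
        (fanoutFn (fstP ∘ fstP) (fanoutFn (fstP ∘ sndP ∘ fstP) sndP))
        (sndP ∘ sndP ∘ fstP))
      (fun _ => [true, true]))

/-- `verInd ∈ FP`. [cite: AroraBarak2009, §1.3] -/
theorem verInd_mem_FP
    (hrun : PolyTimeComputable (fun q : List Bool × ℕ => boolPair q.1 (unaryEncodeNat q.2))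
      optEnc (Function.uncurry run)) :
    verInd run ∈ FP :=
  Brick.andFn_mem_FP
    (comp_mem_FP (lenLeFn_mem_FP X)
      (fanoutFn_mem_FP (comp_mem_FP sndP_mem_FP (comp_mem_FP sndP_mem_FP fstP_mem_FP))
        sndP_mem_FP))
    (comp_mem_FP eqPairFn_mem_FP
      (fanoutFn_mem_FP
        (comp_mem_FP (runStr_mem_FP run hrun)
          (fanoutFn_mem_FP
            (fanoutFn_mem_FP (comp_mem_FP fstP_mem_FP fstP_mem_FP)
              (fanoutFn_mem_FP
                (comp_mem_FP fstP_mem_FP (comp_mem_FP sndP_mem_FP fstP_mem_FP)) sndP_mem_FP))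
            (comp_mem_FP sndP_mem_FP (comp_mem_FP sndP_mem_FP fstP_mem_FP))))
        (const_mem_FP _)))

/-- `verInd` answers with one bit on every word. [folklore] -/
theorem oneBit_verInd : Brick.OneBit (verInd run) := by
  refine Brick.oneBit_andFn (fun w => ?_) (fun w => ?_)
  · rcases lenLeFn_eq_or X (fanoutFn (sndP ∘ sndP ∘ fstP) sndP w) with h | h
    · exact ⟨true, h⟩
    · exact ⟨false, h⟩
  · rcases eqPairFn_eq_or (fanoutFn (runStr run ∘ fanoutFn
        (fanoutFn (fstP ∘ fstP) (fanoutFn (fstP ∘ sndP ∘ fstP) sndP))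
        (sndP ∘ sndP ∘ fstP)) (fun _ => [true, true]) w) with h | h
    · exact ⟨true, h⟩
    · exact ⟨false, h⟩

/-- **Value of the indicator on a well-formed word.** [folklore] -/
theorem verInd_boolPair (k x u y : List Bool) :
    verInd run (boolPair (boolPair k (boolPair x u)) y) =
      [decide (y.length ≤ u.length) &&
        decide (run (boolPair k (boolPair x y)) u.length = some [true])] := by
  unfold verInd
  refine Brick.andFn_apply ?_ ?_
  · simp [fanoutFn_apply, lenLeFn_boolPair]
  · simp [fanoutFn_apply, eqPairFn_boolPair, optEnc_eq_true_true_iff]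

/-- The verifier language `L'`. [BCGL 1992, §6, proof of Thm. 9]
[cite: BendavidEtAl1992, Theorem 9 (proof)] -/
def Lver : Language Bool := {w | verInd run w = [true]}

/-- Membership of a well-formed word in `L'`. [folklore] -/
theorem boolPair_mem_Lver_iff (k x u y : List Bool) :
    boolPair (boolPair k (boolPair x u)) y ∈ Lver run ↔
      y.length ≤ u.length ∧ run (boolPair k (boolPair x y)) u.length = some [true] := by
  change verInd run _ = [true] ↔ _
  rw [verInd_boolPair]
  simp [Bool.and_eq_true]

/-- **`L' ∈ P`.** [BCGL 1992, §6 (proof of Thm. 9: `BH ∈ NP`); Arora–Barak 2009, Thm. 1.9]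
[cite: BendavidEtAl1992, Theorem 9 (proof)] -/
theorem Lver_mem_P
    (hrun : PolyTimeComputable (fun q : List Bool × ℕ => boolPair q.1 (unaryEncodeNat q.2))
      optEnc (Function.uncurry run)) :
    Lver run ∈ Classes.P := by
  refine mem_P_of_mem_FP (verInd_mem_FP run hrun) (Lver run) fun w => ⟨fun h => h, fun h => ?_⟩
  obtain ⟨b, hb⟩ := oneBit_verInd run w
  cases b
  · exact hb
  · exact absurd hb h

/-- **The complete language** `L⋆ = {v | ∃ y, |y| ≤ |v| ∧ ⟨v, y⟩ ∈ L'}`: the instance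
`v = ⟨k, ⟨x, 1ᴺ⟩⟩` asks whether the machine coded by `k` accepts `⟨x, y⟩` for some witness
`|y| ≤ N` within the budget `N` of the universal machine (BCGL's bounded halting `BH`, relation
`R_BH(⟨M, x, 1ᵏ⟩, y)`). [BCGL 1992, §2 (BH) and §6, proof of Thm. 9]
[cite: BendavidEtAl1992, Theorem 9 (proof)] -/
def Lstar : Language Bool :=
  {v | ∃ y : List Bool, y.length ≤ (X : Polynomial ℕ).eval v.length ∧ boolPair v y ∈ Lver run}

/-- **`L⋆ ∈ NP`** (it is `∃ᵖ·L'` with the witness bound `X`). [BCGL 1992, §6, proof of Thm. 9]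
[cite: BendavidEtAl1992, Theorem 9 (proof)] -/
theorem Lstar_mem_NP
    (hrun : PolyTimeComputable (fun q : List Bool × ℕ => boolPair q.1 (unaryEncodeNat q.2))
      optEnc (Function.uncurry run)) :
    Lstar run ∈ NP :=
  ⟨Lver run, Lver_mem_P run hrun, X, fun _ => Iff.rfl⟩

/-- Membership of a well-formed instance `⟨k, ⟨x, u⟩⟩` in `L⋆`. [folklore] -/
theorem boolPair_mem_Lstar_iff (k x u : List Bool) :
    boolPair k (boolPair x u) ∈ Lstar run ↔
      ∃ y : List Bool, y.length ≤ u.length ∧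
        run (boolPair k (boolPair x y)) u.length = some [true] := by
  constructor
  · rintro ⟨y, -, hy⟩
    exact ⟨y, ((boolPair_mem_Lver_iff run k x u y).1 hy).1, ((boolPair_mem_Lver_iff run k x u y).1 hy).2⟩
  · rintro ⟨y, hy, hr⟩
    refine ⟨y, ?_, (boolPair_mem_Lver_iff run k x u y).2 ⟨hy, hr⟩⟩
    simp only [eval_X, length_boolPair]
    omega

/-! ### The universal sampler -/

/-- Field accessors of the sampler's input `z = ⟨u, ⟨k, ⟨ν, ⟨λ, ρ⟩⟩⟩⟩` (`u = 1ᴺ` the parameter,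
read by `fstP`; the rest are the coins): the code field `k` of the coins. [folklore] -/
def kS : List Bool → List Bool := fstP ∘ sndP
/-- the numeral `ν` (input length of the simulated sampler) [folklore] -/
def nuS : List Bool → List Bool := fstP ∘ sndP ∘ sndP
/-- the numeral `λ` (number of coins of the simulated sampler) [folklore] -/
def lamS : List Bool → List Bool := fstP ∘ sndP ∘ sndP ∘ sndP
/-- the remaining coins `ρ` [folklore] -/
def rhoS : List Bool → List Bool := sndP ∘ sndP ∘ sndP ∘ sndP

/-- `kS ∈ FP`. [folklore] -/
theorem kS_mem_FP : kS ∈ FP := comp_mem_FP fstP_mem_FP sndP_mem_FP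
/-- `nuS ∈ FP`. [folklore] -/
theorem nuS_mem_FP : nuS ∈ FP := comp_mem_FP fstP_mem_FP (comp_mem_FP sndP_mem_FP sndP_mem_FP)
/-- `lamS ∈ FP`. [folklore] -/
theorem lamS_mem_FP : lamS ∈ FP :=
  comp_mem_FP fstP_mem_FP (comp_mem_FP sndP_mem_FP (comp_mem_FP sndP_mem_FP sndP_mem_FP))
/-- `rhoS ∈ FP`. [folklore] -/
theorem rhoS_mem_FP : rhoS ∈ FP :=
  comp_mem_FP sndP_mem_FP (comp_mem_FP sndP_mem_FP (comp_mem_FP sndP_mem_FP sndP_mem_FP))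

/-- The program handed to the universal machine: `⟨k, ⟨1^{min ⟦ν⟧ |u|}, ρ ↾ min ⟦λ⟧ |u|⟩⟩`
(bounded binary-to-unary conversions `binToUnaryFn`, truncation `Plumb.takeFn`).
[BCGL 1992, §6, proof of Thm. 9 ("next sample `νᵢ`")] [cite: BendavidEtAl1992, Theorem 9 (proof)] -/
noncomputable def progS : List Bool → List Bool :=
  fanoutFn kS
    (fanoutFn (binToUnaryFn ∘ fanoutFn fstP nuS)
      (Plumb.takeFn ∘ fanoutFn (binToUnaryFn ∘ fanoutFn fstP lamS) rhoS))

/-- `progS ∈ FP`. [cite: AroraBarak2009, §1.3] -/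
theorem progS_mem_FP : progS ∈ FP :=
  fanoutFn_mem_FP kS_mem_FP
    (fanoutFn_mem_FP (comp_mem_FP binToUnaryFn_mem_FP (fanoutFn_mem_FP fstP_mem_FP nuS_mem_FP))
      (comp_mem_FP Plumb.takeFn_mem_FP
        (fanoutFn_mem_FP (comp_mem_FP binToUnaryFn_mem_FP (fanoutFn_mem_FP fstP_mem_FP lamS_mem_FP))
          rhoS_mem_FP)))

/-- Value of the program on a well-formed input. [folklore] -/
theorem progS_apply (u k ν lam ρ : List Bool) :
    progS (boolPair u (boolPair k (boolPair ν (boolPair lam ρ)))) =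
      boolPair k (boolPair (ones (min (bitsToNat ν) u.length))
        (ρ.take (min (bitsToNat lam) u.length))) := by
  simp [progS, kS, nuS, lamS, rhoS, fanoutFn_apply]

/-- The output of the simulated sampler: `(run prog |u|).getD []` (drop the tag of `optEnc`).
[folklore] -/
noncomputable def outS : List Bool → List Bool :=
  List.tail ∘ runStr run ∘ fanoutFn progS fstP

/-- `outS ∈ FP`. [cite: AroraBarak2009, Thm. 1.9 and §1.3] -/
theorem outS_mem_FP
    (hrun : PolyTimeComputable (fun q : List Bool × ℕ => boolPair q.1 (unaryEncodeNat q.2))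
      optEnc (Function.uncurry run)) :
    outS run ∈ FP :=
  comp_mem_FP PRelSigma.tail_mem_FP
    (comp_mem_FP (runStr_mem_FP run hrun) (fanoutFn_mem_FP progS_mem_FP fstP_mem_FP))

/-- Value of `outS` on a well-formed input. [folklore] -/
theorem outS_apply (u k ν lam ρ : List Bool) :
    outS run (boolPair u (boolPair k (boolPair ν (boolPair lam ρ)))) =
      (run (boolPair k (boolPair (ones (min (bitsToNat ν) u.length))
        (ρ.take (min (bitsToNat lam) u.length)))) u.length).getD [] := by
  simp [outS, progS_apply]

/-- **The universal sampler as a string function**: `z = ⟨1ᴺ, coins⟩ ↦ ⟨e', ⟨x', 1ᴺ⟩⟩` where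
`⟨e', x'⟩` is the output of the simulated (image) sampler. [BCGL 1992, §6, proof of Thm. 9
(the universal distribution `ν_U`)] [cite: BendavidEtAl1992, Theorem 9 (proof)] -/
noncomputable def sampFn : List Bool → List Bool :=
  fanoutFn (fstP ∘ outS run) (fanoutFn (sndP ∘ outS run) (onesFn ∘ fstP))

/-- **`sampFn ∈ FP`.** [cite: AroraBarak2009, Thm. 1.9 and §1.3] -/
theorem sampFn_mem_FP
    (hrun : PolyTimeComputable (fun q : List Bool × ℕ => boolPair q.1 (unaryEncodeNat q.2))
      optEnc (Function.uncurry run)) :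
    sampFn run ∈ FP :=
  fanoutFn_mem_FP (comp_mem_FP fstP_mem_FP (outS_mem_FP run hrun))
    (fanoutFn_mem_FP (comp_mem_FP sndP_mem_FP (outS_mem_FP run hrun))
      (comp_mem_FP onesFn_mem_FP fstP_mem_FP))

/-- **Value of the universal sampler on a well-formed input** `⟨u, ⟨k, ⟨ν, ⟨λ, ρ⟩⟩⟩⟩`: with
`o = (run ⟨k, ⟨1^{min ⟦ν⟧ |u|}, ρ ↾ min ⟦λ⟧ |u|⟩⟩ |u|).getD ε`, the output is
`⟨fst o, ⟨snd o, 1^{|u|}⟩⟩`. [folklore] -/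
theorem sampFn_apply (u k ν lam ρ : List Bool) :
    sampFn run (boolPair u (boolPair k (boolPair ν (boolPair lam ρ)))) =
      boolPair
        (fstP ((run (boolPair k (boolPair (ones (min (bitsToNat ν) u.length))
          (ρ.take (min (bitsToNat lam) u.length)))) u.length).getD []))
        (boolPair
          (sndP ((run (boolPair k (boolPair (ones (min (bitsToNat ν) u.length))
            (ρ.take (min (bitsToNat lam) u.length)))) u.length).getD []))
          (ones u.length)) := by
  simp only [sampFn, fanoutFn_apply, Function.comp_apply, outS_apply, fstP_boolPair]
  rw [show onesFn u = ones u.length from unaryEncodeNat_eq_ones u.length]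

/-- **The universal sampler** (coin budget `N` on `1ᴺ`). [BCGL 1992, §6, proof of Thm. 9]
[cite: BendavidEtAl1992, Theorem 9 (proof)] -/
noncomputable def univSampler : RandAlg ℕ (List Bool) where
  run N r := sampFn run (boolPair (unaryEncodeNat N) r)
  coinLen n := n

/-- **The universal sampler is polynomial time** (it is an `FP` function of `⟨1ᴺ, r⟩`).
[cite: BendavidEtAl1992, Theorem 9 (proof)] -/
theorem univSampler_isPolyTime
    (hrun : PolyTimeComputable (fun q : List Bool × ℕ => boolPair q.1 (unaryEncodeNat q.2))
      optEnc (Function.uncurry run)) :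
    (univSampler run).IsPolyTime unaryEncodeNat (id : List Bool → List Bool) := by
  refine ⟨?_, X, fun n => by simp [univSampler]⟩
  obtain ⟨p, M, hM⟩ := sampFn_mem_FP run hrun
  exact ⟨p, M, fun a => hM (boolPair (unaryEncodeNat a.1) a.2)⟩

/-- **The universal ensemble** `U_N` = the output distribution of the universal sampler on `1ᴺ`.
[BCGL 1992, §6, proof of Thm. 9 (`ν_U`)] [cite: BendavidEtAl1992, Theorem 9 (proof)] -/
noncomputable def univEnsemble : Ensemble := fun N => (univSampler run).outputPMF unaryEncodeNat N

/-- `U ∈ PSamp` (by construction). [cite: BendavidEtAl1992, Theorem 9 (proof)] -/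
theorem univEnsemble_mem_PSamp
    (hrun : PolyTimeComputable (fun q : List Bool × ℕ => boolPair q.1 (unaryEncodeNat q.2))
      optEnc (Function.uncurry run)) :
    univEnsemble run ∈ PSamp :=
  ⟨univSampler run, univSampler_isPolyTime run hrun, fun _ => rfl⟩

/-- **The complete distributional problem** `(L⋆, U)`. [BCGL 1992, §6, Thm. 9]
[cite: BendavidEtAl1992, Theorem 9] -/
noncomputable def univProblem : DistProblem := ⟨Lstar run, univEnsemble run⟩

/-- `(L⋆, U) ∈ DistNP`. [cite: BendavidEtAl1992, Theorem 9] -/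
theorem univProblem_mem_DistNP
    (hrun : PolyTimeComputable (fun q : List Bool × ℕ => boolPair q.1 (unaryEncodeNat q.2))
      optEnc (Function.uncurry run)) :
    univProblem run ∈ DistNP :=
  ⟨Lstar_mem_NP run hrun, univEnsemble_mem_PSamp run hrun⟩

/-! ### Counting: a fixed prefix of the coins costs a factor `2^{|prefix|}` -/

/-- **Prefix counting between uniform coin spaces.** Let `pre` be a fixed word and
`|pre| + ℓ ≤ K`. If every coin string of the shape `pre ρ pad` (`|ρ| = ℓ`, `pad` filling up to
length `K`) with `a ρ = x₀` satisfies `G (pre ρ pad) = y`, then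
`Pr_{ρ ∈ {0,1}^ℓ}[a ρ = x₀] ≤ 2^{|pre|} · Pr_{r ∈ {0,1}^K}[G r = y]`: the map `(ρ, pad) ↦ pre ρ pad`
is injective, so `#{r | G r = y} ≥ #{ρ | a ρ = x₀} · 2^{K - |pre| - ℓ}`. This is the estimate
"`ν_U(x) ≥ (1/j²) νⱼ(x)`" of the printed proof, the weight `1/j²` of the index being here the
probability `2^{-|pre|}` of a self-delimiting prefix of the coins.
[BCGL 1992, §6, proof of Thm. 9] [cite: BendavidEtAl1992, Theorem 9 (proof)] -/
theorem map_apply_le_of_prefix {K ℓ : ℕ} (pre : List Bool) (hK : pre.length + ℓ ≤ K)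
    (G : List Bool → List Bool) (a : List Bool → List Bool) (x₀ y : List Bool)
    (hG : ∀ ρ pad : List Bool, ρ.length = ℓ → pad.length = K - pre.length - ℓ →
      a ρ = x₀ → G (pre ++ ρ ++ pad) = y) :
    ((PMF.uniformOfFintype (List.Vector Bool ℓ)).map fun ρ => a ρ.toList) x₀ ≤
      2 ^ pre.length *
        ((PMF.uniformOfFintype (List.Vector Bool K)).map fun r => G r.toList) y := by
  classical
  set P := pre.length with hP
  set S₁ : Set (List.Vector Bool ℓ) := (fun ρ => a ρ.toList) ⁻¹' {x₀} with hS₁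
  set S₂ : Set (List.Vector Bool K) := (fun r => G r.toList) ⁻¹' {y} with hS₂
  -- the injection `(ρ, pad) ↦ pre ρ pad`
  have hlen : ∀ (ρ : List.Vector Bool ℓ) (pad : List.Vector Bool (K - P - ℓ)),
      (pre ++ ρ.toList ++ pad.toList).length = K := by
    intro ρ pad
    simp only [List.length_append, List.Vector.toList_length]
    omega
  let Φ : S₁ × List.Vector Bool (K - P - ℓ) → S₂ := fun q =>
    ⟨⟨pre ++ q.1.1.toList ++ q.2.toList, hlen q.1.1 q.2⟩, by
      change G (pre ++ q.1.1.toList ++ q.2.toList) ∈ ({y} : Set (List Bool))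
      rw [Set.mem_singleton_iff]
      exact hG _ _ q.1.1.toList_length q.2.toList_length (Set.mem_singleton_iff.1 q.1.2)⟩
  have hΦ : Function.Injective Φ := by
    rintro ⟨⟨ρ, hρ⟩, pad⟩ ⟨⟨ρ', hρ'⟩, pad'⟩ h
    have h1 : pre ++ ρ.toList ++ pad.toList = pre ++ ρ'.toList ++ pad'.toList :=
      congrArg (fun v : S₂ => v.1.toList) h
    rw [List.append_assoc, List.append_assoc] at h1
    have h2 := List.append_cancel_left h1
    have h3 := List.append_inj h2 (by simp)
    have hρρ' : ρ = ρ' := List.Vector.ext_iff.2 fun i => by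
      have := congrArg (fun l => l[i.1]?) h3.1
      simpa [List.Vector.getElem_def] using List.Vector.toList_injective h3.1 ▸ rfl
    subst hρρ'
    have hpp : pad = pad' := List.Vector.toList_injective h3.2
    subst hpp
    rfl
  have hcard : Fintype.card S₁ * 2 ^ (K - P - ℓ) ≤ Fintype.card S₂ := by
    have := Fintype.card_le_of_injective Φ hΦ
    rwa [Fintype.card_prod, card_vector, Fintype.card_bool] at this
  -- the two probabilities as counting fractions
  rw [← PMF.toOuterMeasure_apply_singleton, PMF.toOuterMeasure_map_apply,
    ← PMF.toOuterMeasure_apply_singleton (PMF.map _ _), PMF.toOuterMeasure_map_apply,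
    PMF.toOuterMeasure_uniformOfFintype_apply, PMF.toOuterMeasure_uniformOfFintype_apply,
    card_vector, card_vector, Fintype.card_bool]
  change ((Fintype.card S₁ : ℕ) : ℝ≥0∞) / ((2 ^ ℓ : ℕ) : ℝ≥0∞) ≤
    2 ^ P * (((Fintype.card S₂ : ℕ) : ℝ≥0∞) / ((2 ^ K : ℕ) : ℝ≥0∞))
  have hcast : ((Fintype.card S₁ : ℕ) : ℝ≥0∞) * 2 ^ (K - P - ℓ) * 2 ^ P ≤
      (Fintype.card S₂ : ℕ) * 2 ^ P := by
    gcongr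
    exact_mod_cast hcard
  have h2 : (2 : ℝ≥0∞) ^ ℓ * (2 ^ (K - P - ℓ) * 2 ^ P) = 2 ^ K := by
    rw [← pow_add, ← pow_add]; congr 1; omega
  have hne : (2 : ℝ≥0∞) ^ (K - P - ℓ) * 2 ^ P ≠ 0 := by positivity
  have hnt : (2 : ℝ≥0∞) ^ (K - P - ℓ) * 2 ^ P ≠ ∞ :=
    ENNReal.mul_ne_top (ENNReal.pow_ne_top ENNReal.ofNat_ne_top) (ENNReal.pow_ne_top ENNReal.ofNat_ne_top)
  push_cast
  calc ((Fintype.card S₁ : ℕ) : ℝ≥0∞) / 2 ^ ℓ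
      = (Fintype.card S₁ : ℕ) * (2 ^ (K - P - ℓ) * 2 ^ P) / (2 ^ ℓ * (2 ^ (K - P - ℓ) * 2 ^ P)) :=
        (ENNReal.mul_div_mul_right _ _ hne hnt).symm
    _ = (Fintype.card S₁ : ℕ) * 2 ^ (K - P - ℓ) * 2 ^ P / 2 ^ K := by rw [h2, mul_assoc]
    _ ≤ (Fintype.card S₂ : ℕ) * 2 ^ P / 2 ^ K := ENNReal.div_le_div_right hcast _
    _ = 2 ^ P * ((Fintype.card S₂ : ℕ) / 2 ^ K) := by rw [mul_comm, mul_div_assoc]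

/-! ### The reduction `x ↦ ⟨e, ⟨x, 1^{m(n)}⟩⟩` -/

/-- `⟨a, b⟩ = ⟨a', b'⟩ ↔ a = a' ∧ b = b'`. [folklore] -/
private theorem boolPair_inj {a b a' b' : List Bool} :
    boolPair a b = boolPair a' b' ↔ a = a' ∧ b = b' := by
  constructor
  · intro h
    have := boolPair_injective (a₁ := (a, b)) (a₂ := (a', b')) h
    simpa using this
  · rintro ⟨rfl, rfl⟩; rfl

/-- **The reduction map is polynomial time**: `⟨x, 1ⁿ⟩ ↦ ⟨e, ⟨x, 1^{m(n)}⟩⟩` is the `FP` brick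
expression `⟨e, ⟨fst z, polyFn m (snd z)⟩⟩`. [BCGL 1992, §6, proof of Thm. 9 ("`f` is computable
in quadratic time")] [cite: BendavidEtAl1992, Theorem 9 (proof)] -/
theorem reduce_polyTime (e : List Bool) (m : Polynomial ℕ) :
    PolyTimeComputable paramEnc (id : List Bool → List Bool)
      (Function.uncurry fun (x : List Bool) (n : ℕ) =>
        boolPair e (boolPair x (unaryEncodeNat (m.eval n)))) := by
  obtain ⟨p, M, hM⟩ :=
    fanoutFn_mem_FP (const_mem_FP e) (fanoutFn_mem_FP fstP_mem_FP (comp_mem_FP (Plumb.polyFn_mem_FP m) sndP_mem_FP))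
  refine ⟨p, M, fun a => ?_⟩
  obtain ⟨x, n⟩ := a
  have h := hM (paramEnc (x, n))
  have hval : fanoutFn (fun _ => e) (fanoutFn fstP (Plumb.polyFn m ∘ sndP)) (paramEnc (x, n)) =
      boolPair e (boolPair x (unaryEncodeNat (m.eval n))) := by
    simp [paramEnc, fanoutFn_apply, unaryEncodeNat_eq_ones]
  rw [show (id (fanoutFn (fun _ => e) (fanoutFn fstP (Plumb.polyFn m ∘ sndP)) (paramEnc (x, n))) :
      List Bool) = id (boolPair e (boolPair x (unaryEncodeNat (m.eval n)))) from hval] at h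
  exact h

/-- **Correctness of the reduction** on strings of length `≤ S`, for budgets `N` beyond the
decider's clock. Let `L_V, p_L` present `L ∈ NP`, let `M_V` decide `LenLe p_L ∩ L_V` within
`T(|w|)` steps, with code `e` and overhead `p_e`. If `|x| ≤ S`, `p_e(T(2S + 2 + p_L S)) ≤ N` and
`p_L S ≤ N`, then `⟨e, ⟨x, 1ᴺ⟩⟩ ∈ L⋆ ↔ x ∈ L`. Soundness uses only that `run` is a *monotone
function* of the budget: an accepting budget `N` and the budget `p_e(T |⟨x, y⟩|)` at which the
(total) decider's true answer appears both persist to their maximum, where they must agree.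
[BCGL 1992, §6, proof of Thm. 9 ("`M` is an NP machine for `D` and `k` is a bound on the running
time of `M`")] [cite: BendavidEtAl1992, Theorem 9 (proof)] -/
theorem reduction_correct
    (hmono : ∀ {prog : List Bool} {t t' : ℕ} {y : List Bool},
      t ≤ t' → run prog t = some y → run prog t' = some y)
    {L LV : Language Bool} {pL : Polynomial ℕ}
    (hver : ∀ x, x ∈ L ↔ ∃ y : List Bool, y.length ≤ pL.eval x.length ∧ boolPair x y ∈ LV)
    {MV : Turing.TM2ComputableAux Bool Bool} {T : Polynomial ℕ}
    (hMV : ∀ w, MV.OutputsWithin w (encodeBool ((LenLe pL ⊓ LV).boolIndicator w)) (T.eval w.length))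
    {e : List Bool} {pe : Polynomial ℕ}
    (hsim : ∀ (w y : List Bool) (t : ℕ), MV.OutputsWithin w y t →
      run (boolPair e w) (pe.eval t) = some y)
    {x : List Bool} {S N : ℕ} (hx : x.length ≤ S)
    (hN1 : pe.eval (T.eval (2 * S + 2 + pL.eval S)) ≤ N) (hN2 : pL.eval S ≤ N) :
    boolPair e (boolPair x (unaryEncodeNat N)) ∈ Lstar run ↔ x ∈ L := by
  rw [boolPair_mem_Lstar_iff, length_unaryEncodeNat]
  constructor
  · rintro ⟨y, -, hr⟩
    have hdec := hMV (boolPair x y)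
    have h1 := hsim _ _ _ hdec
    have h2 := hmono (le_max_left N (pe.eval (T.eval (boolPair x y).length))) hr
    have h3 := hmono (le_max_right N (pe.eval (T.eval (boolPair x y).length))) h1
    have h4 : encodeBool ((LenLe pL ⊓ LV).boolIndicator (boolPair x y)) = [true] :=
      Option.some.inj (h3.symm.trans h2)
    have hb : (LenLe pL ⊓ LV).boolIndicator (boolPair x y) = true := by
      change [(LenLe pL ⊓ LV).boolIndicator (boolPair x y)] = [true] at h4
      simpa using h4
    have hw : boolPair x y ∈ LenLe pL ⊓ LV := (Set.mem_iff_boolIndicator _ _).2 hb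
    have hw' : boolPair x y ∈ LenLe pL ∧ boolPair x y ∈ LV := hw
    exact (hver x).2 ⟨y, (boolPair_mem_LenLe pL x y).1 hw'.1, hw'.2⟩
  · intro hxL
    obtain ⟨y, hy, hyV⟩ := (hver x).1 hxL
    have hw : boolPair x y ∈ LenLe pL ⊓ LV := ⟨(boolPair_mem_LenLe pL x y).2 hy, hyV⟩
    have hb : (LenLe pL ⊓ LV).boolIndicator (boolPair x y) = true :=
      (Set.mem_iff_boolIndicator _ _).1 hw
    have hdec := hMV (boolPair x y)
    rw [hb] at hdec
    have hyS : y.length ≤ pL.eval S := hy.trans (natPoly_eval_mono pL hx)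
    have hlen : (boolPair x y).length ≤ 2 * S + 2 + pL.eval S := by
      rw [length_boolPair]; omega
    have h1 := hsim _ _ _ (hdec.mono (natPoly_eval_mono T hlen))
    exact ⟨y, hyS.trans hN2, hmono hN1 h1⟩

/-! ### The image sampler and the domination bound -/

/-- **The image sampler as one machine.** For a polynomial-time sampler `A` (machine on
`⟨1ⁿ, ρ⟩`) and a word `e`, some `TM2` machine maps `⟨1ⁿ, ρ⟩` to `⟨e, A(1ⁿ, ρ)⟩` within `τ(n)`
steps whenever `|ρ| = coinLen n` (sequential composition `Turing.TM2ComputableAux.comp` of the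
machine of `A` with the `FP` map `s ↦ ⟨e, s⟩`; the output of `A` has polynomial length,
`RandAlg.IsPolyTime.exists_length_run_le`). This is BCGL's sampler "`S` followed by `f`".
[BCGL 1992, §6, proof of Thm. 9] [cite: BendavidEtAl1992, Theorem 9 (proof)] -/
theorem exists_imageSampler {A : RandAlg ℕ (List Bool)}
    (hA : A.IsPolyTime unaryEncodeNat (id : List Bool → List Bool)) (e : List Bool) :
    ∃ (B : Turing.TM2ComputableAux Bool Bool) (τ : Polynomial ℕ), ∀ (n : ℕ) (ρ : List Bool),
      ρ.length = A.coinLen n →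
        B.OutputsWithin (boolPair (unaryEncodeNat n) ρ) (boolPair e (A.run n ρ)) (τ.eval n) := by
  obtain ⟨⟨pA, MA, hMA⟩, qA, hqA⟩ := hA
  obtain ⟨Px, hPx⟩ := RandAlg.IsPolyTime.exists_length_run_le (A := A) ⟨⟨pA, MA, hMA⟩, qA, hqA⟩
  obtain ⟨ph, Mh, hMh⟩ := fanoutFn_mem_FP (const_mem_FP e) OracleCompose.id_mem_FP
  refine ⟨MA.comp Mh, ph.comp Px + pA.comp (C 2 * X + C 2 + qA), fun n ρ hρ => ?_⟩
  have h1 := hMA (n, ρ)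
  simp only [Function.uncurry_apply_pair, id] at h1
  have h2 := hMh (A.run n ρ)
  rw [show (id (fanoutFn (fun _ => e) id (A.run n ρ)) : List Bool) = boolPair e (A.run n ρ) from
    by simp [fanoutFn_apply]] at h2
  refine (Turing.TM2ComputableAux.comp_outputsWithin MA Mh h1 h2).mono ?_
  have hx : (A.run n ρ).length ≤ Px.eval n := hPx n ρ hρ
  have hl : (boolPair (unaryEncodeNat n) ρ).length ≤ 2 * n + 2 + qA.eval n := by
    rw [length_boolPair, length_unaryEncodeNat, hρ]; have := hqA n; omega
  simp only [eval_add, eval_comp, eval_mul, eval_C, eval_X, id]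
  exact Nat.add_le_add (natPoly_eval_mono ph hx) (natPoly_eval_mono pA hl)

/-- `⟨a, ⟨b, ⟨c, ε⟩⟩⟩ s = ⟨a, ⟨b, ⟨c, s⟩⟩⟩`. [folklore] -/
private theorem pre3_append (a b c s : List Bool) :
    boolPair a (boolPair b (boolPair c [])) ++ s = boolPair a (boolPair b (boolPair c s)) := by
  simp [boolPair, List.append_assoc]

/-- **The domination bound for one instance.** With `B` the image sampler (code `e_B`,
overhead `p_B`, clock `τ`) and a budget `N ≥ p_B(τ n)` leaving room for the prefix
`pre = ⟨e_B, ⟨bin n, ⟨bin ℓₙ, ε⟩⟩⟩` (`ℓₙ = coinLen n`) and `ℓₙ` coins, every `x₀` has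
`Dₙ(x₀) = Pr_ρ[A(1ⁿ, ρ) = x₀] ≤ 2^{|pre|} · U_N(⟨e, ⟨x₀, 1ᴺ⟩⟩)`: the coins `pre ρ pad` make the
universal sampler simulate `B` on `⟨1ⁿ, ρ⟩` to completion and output `⟨e, ⟨A(1ⁿ, ρ), 1ᴺ⟩⟩`
(`sampFn_apply`, `map_apply_le_of_prefix`). [BCGL 1992, §6, proof of Thm. 9
("`νⱼ = f(μ)`, clearly `(D, μ) ∝ (BH, ν_U)`")] [cite: BendavidEtAl1992, Theorem 9 (proof)] -/
theorem outputPMF_apply_le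
    (hmono : ∀ {prog : List Bool} {t t' : ℕ} {y : List Bool},
      t ≤ t' → run prog t = some y → run prog t' = some y)
    {A : RandAlg ℕ (List Bool)} {e eB : List Bool} {B : Turing.TM2ComputableAux Bool Bool}
    {τ pB : Polynomial ℕ}
    (hB : ∀ (n : ℕ) (ρ : List Bool), ρ.length = A.coinLen n →
      B.OutputsWithin (boolPair (unaryEncodeNat n) ρ) (boolPair e (A.run n ρ)) (τ.eval n))
    (hsimB : ∀ (w y : List Bool) (t : ℕ), B.OutputsWithin w y t →
      run (boolPair eB w) (pB.eval t) = some y)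
    (n N : ℕ) (hn : n ≤ N) (hNsim : pB.eval (τ.eval n) ≤ N)
    (hNlen : (boolPair eB (boolPair (encodeNat n) (boolPair (encodeNat (A.coinLen n)) []))).length +
      A.coinLen n ≤ N)
    (x₀ : List Bool) :
    (A.outputPMF unaryEncodeNat n) x₀ ≤
      2 ^ (boolPair eB (boolPair (encodeNat n) (boolPair (encodeNat (A.coinLen n)) []))).length *
        univEnsemble run N (boolPair e (boolPair x₀ (unaryEncodeNat N))) := by
  -- the two coin lengths, without rewriting inside the types
  have hℓ : A.coinLen (unaryEncodeNat n).length = A.coinLen n := by rw [length_unaryEncodeNat]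
  have hK : (univSampler run).coinLen (unaryEncodeNat N).length = N := length_unaryEncodeNat N
  change ((PMF.uniformOfFintype (List.Vector Bool (A.coinLen (unaryEncodeNat n).length))).map
      fun r => A.run n r.toList) x₀ ≤
    2 ^ _ * ((PMF.uniformOfFintype
      (List.Vector Bool ((univSampler run).coinLen (unaryEncodeNat N).length))).map
        fun r => (univSampler run).run N r.toList) _
  refine map_apply_le_of_prefix _ (by rw [hℓ, hK]; exact hNlen) _ _ x₀ _ fun ρ pad hρ _ hx => ?_
  rw [hℓ] at hρ
  change sampFn run (boolPair (unaryEncodeNat N) (_ ++ ρ ++ pad)) = _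
  rw [List.append_assoc, pre3_append, sampFn_apply, length_unaryEncodeNat, bitsToNat_encodeNat,
    bitsToNat_encodeNat, Nat.min_eq_left hn, Nat.min_eq_left (by omega : A.coinLen n ≤ N), ← hρ,
    List.take_left, ← unaryEncodeNat_eq_ones n,
    hmono hNsim (hsimB _ _ _ (hB n ρ hρ)), Option.getD_some, fstP_boolPair, sndP_boolPair, hx,
    ← unaryEncodeNat_eq_ones N]

/-- `2^{|pre|}` is polynomial: `2^{|⟨e_B, ⟨bin n, ⟨bin ℓ, ε⟩⟩⟩|} ≤ 2^{2|e_B|+6} (2n+1)² (2q+1)²`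
for `ℓ ≤ q`. [folklore] -/
private theorem two_pow_prefix_le (eB : List Bool) (n ℓ q : ℕ) (hℓ : ℓ ≤ q) :
    2 ^ (boolPair eB (boolPair (encodeNat n) (boolPair (encodeNat ℓ) []))).length ≤
      2 ^ (2 * eB.length + 6) * ((2 * n + 1) ^ 2 * (2 * q + 1) ^ 2) := by
  have ha := two_pow_length_encodeNat_le n
  have hb : 2 ^ (encodeNat ℓ).length ≤ 2 * q + 1 := (two_pow_length_encodeNat_le ℓ).trans (by omega)
  have hexp : (boolPair eB (boolPair (encodeNat n) (boolPair (encodeNat ℓ) []))).length =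
      (2 * eB.length + 6) + 2 * (encodeNat n).length + 2 * (encodeNat ℓ).length := by
    simp only [length_boolPair, List.length_nil]; ring
  rw [hexp, pow_add, pow_add, pow_mul', pow_mul', mul_assoc]
  exact Nat.mul_le_mul_left _
    (Nat.mul_le_mul (Nat.pow_le_pow_left ha 2) (Nat.pow_le_pow_left hb 2))

/-- The prefix and the coins fit: `|⟨e_B, ⟨bin n, ⟨bin ℓ, ε⟩⟩⟩| + ℓ ≤ 2|e_B| + 6 + 4n + 5q` for
`ℓ ≤ q`. [folklore] -/
private theorem prefix_length_add_le (eB : List Bool) (n ℓ q : ℕ) (hℓ : ℓ ≤ q) :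
    (boolPair eB (boolPair (encodeNat n) (boolPair (encodeNat ℓ) []))).length + ℓ ≤
      2 * eB.length + 6 + 4 * n + 5 * q := by
  have ha := length_encodeNat_le_two_mul n
  have hb := length_encodeNat_le_two_mul ℓ
  simp only [length_boolPair, List.length_nil]
  omega

/-! ### Hardness and completeness -/

/-- **`(L⋆, U)` is `DistNP`-hard.** For `(L, D) ∈ (NP, PSamp)`: present `L` by `L_V ∈ P`, `p_L`;
decide `LenLe p_L ∩ L_V` by `M_V` (code `e`, overhead `p_e`, clock `T`); sample `D` by `A` (coins
`≤ q_A`, support lengths `≤ s`); form the image sampler `B` (code `e_B`, overhead `p_B`, clock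
`τ`); put `m = p_e ∘ T ∘ (2s + 2 + p_L ∘ s) + p_L ∘ s + (2|e_B| + 6 + 4X + 5q_A) + p_B ∘ τ` and
`f(x; n) = ⟨e, ⟨x, 1^{m(n)}⟩⟩`. Then `f` is polynomial time (`reduce_polyTime`), correct on
`supp Dₙ` (`reduction_correct`), and `Dₙ{x | f(x; n) = y} ≤ p(n) · U_{m(n)}(y)` with
`p = 2^{2|e_B|+6} (2X+1)² (2q_A+1)²` (`outputPMF_apply_le`; a fibre of `f(·; n)` is empty or a
point). [BCGL 1992, §6, Thm. 9 (proof)] [cite: BendavidEtAl1992, Theorem 9 (proof)] -/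
theorem univProblem_isDistHard
    (hmono : ∀ {prog : List Bool} {t t' : ℕ} {y : List Bool},
      t ≤ t' → run prog t = some y → run prog t' = some y)
    (hsim : ∀ M : Turing.TM2ComputableAux Bool Bool, ∃ (e : List Bool) (p : Polynomial ℕ),
      ∀ (w y : List Bool) (t : ℕ), M.OutputsWithin w y t → run (boolPair e w) (p.eval t) = some y) :
    IsDistHard DistNP (univProblem run) := by
  rintro ⟨L, D⟩ ⟨hL, hD⟩
  -- the verifier of `L` and its clocked decider
  obtain ⟨LV, hLV, pL, hver⟩ := hL
  obtain ⟨T, MV, hMV⟩ := mem_P_iff_holds.1 (inter_mem_P (LenLe_mem_P pL) hLV)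
  obtain ⟨e, pe, hsimV⟩ := hsim MV
  -- the sampler of `D`, its coin bound, its support lengths, and the image sampler
  obtain ⟨A, hA, hout⟩ := hD
  obtain ⟨s, hs⟩ := Ensemble.IsPolySamplable.hasPolyLength_holds ⟨A, hA, hout⟩
  obtain ⟨qA, hqA⟩ := hA.2
  obtain ⟨B, τ, hB⟩ := exists_imageSampler hA e
  obtain ⟨eB, pB, hsimB⟩ := hsim B
  -- the parameter polynomial
  set m : Polynomial ℕ := pe.comp (T.comp (C 2 * s + C 2 + pL.comp s)) + pL.comp s +
    (C (2 * eB.length + 6) + C 4 * X + C 5 * qA) + pB.comp τ with hm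
  have hmeval : ∀ n, m.eval n = pe.eval (T.eval (2 * s.eval n + 2 + pL.eval (s.eval n))) +
      pL.eval (s.eval n) + (2 * eB.length + 6 + 4 * n + 5 * qA.eval n) + pB.eval (τ.eval n) := by
    intro n; simp [hm, eval_add, eval_mul, eval_comp, eval_X]
  refine ⟨fun x n => boolPair e (boolPair x (unaryEncodeNat (m.eval n))), reduce_polyTime e m,
    fun n x hx => ?_, ?_⟩
  · -- correctness on the support
    exact reduction_correct run hmono hver (fun w => hMV w) hsimV (hs n x hx)
      (by rw [hmeval]; omega) (by rw [hmeval]; omega)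
  · -- domination
    refine ⟨C (2 ^ (2 * eB.length + 6)) * ((C 2 * X + C 1) ^ 2 * (C 2 * qA + C 1) ^ 2), m,
      fun n y => ?_⟩
    have hpeval : (C (2 ^ (2 * eB.length + 6)) * ((C 2 * X + C 1) ^ 2 * (C 2 * qA + C 1) ^ 2) :
        Polynomial ℕ).eval n = 2 ^ (2 * eB.length + 6) * ((2 * n + 1) ^ 2 * (2 * qA.eval n + 1) ^ 2) := by
      simp [eval_add, eval_mul, eval_pow, eval_X]
    by_cases hy : ∃ x₀, boolPair e (boolPair x₀ (unaryEncodeNat (m.eval n))) = y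
    · obtain ⟨x₀, rfl⟩ := hy
      have hset : {x | boolPair e (boolPair x (unaryEncodeNat (m.eval n))) =
          boolPair e (boolPair x₀ (unaryEncodeNat (m.eval n)))} = {x₀} := by
        ext x
        simp only [Set.mem_setOf_eq, Set.mem_singleton_iff, boolPair_inj, true_and, and_true]
      rw [hset, PMF.toOuterMeasure_apply_singleton, ← hout n, hpeval]
      have hcoin : A.coinLen n ≤ qA.eval n := hqA n
      calc (A.outputPMF unaryEncodeNat n) x₀
          ≤ 2 ^ (boolPair eB (boolPair (encodeNat n) (boolPair (encodeNat (A.coinLen n)) []))).length *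
              univEnsemble run (m.eval n) (boolPair e (boolPair x₀ (unaryEncodeNat (m.eval n)))) :=
            outputPMF_apply_le run hmono hB hsimB n (m.eval n) (by rw [hmeval]; omega)
              (by rw [hmeval]; omega)
              (by have := prefix_length_add_le eB n (A.coinLen n) (qA.eval n) hcoin; rw [hmeval]; omega) x₀
        _ ≤ ((2 ^ (2 * eB.length + 6) * ((2 * n + 1) ^ 2 * (2 * qA.eval n + 1) ^ 2) : ℕ) : ℝ≥0∞) *
              univEnsemble run (m.eval n) (boolPair e (boolPair x₀ (unaryEncodeNat (m.eval n)))) := by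
            gcongr
            exact_mod_cast two_pow_prefix_le eB n (A.coinLen n) (qA.eval n) hcoin
    · have hset : {x | boolPair e (boolPair x (unaryEncodeNat (m.eval n))) = y} = ∅ :=
        Set.eq_empty_of_forall_notMem fun x hx => hy ⟨x, hx⟩
      change (D n).toOuterMeasure {x | boolPair e (boolPair x (unaryEncodeNat (m.eval n))) = y} ≤ _
      rw [hset, MeasureTheory.measure_empty]
      exact bot_le

/-- **`(L⋆, U)` is `DistNP`-complete.** [BCGL 1992, §6, Thm. 9]
[cite: BendavidEtAl1992, Theorem 9] -/
theorem univProblem_isDistNPComplete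
    (hmono : ∀ {prog : List Bool} {t t' : ℕ} {y : List Bool},
      t ≤ t' → run prog t = some y → run prog t' = some y)
    (hrun : PolyTimeComputable (fun q : List Bool × ℕ => boolPair q.1 (unaryEncodeNat q.2))
      optEnc (Function.uncurry run))
    (hsim : ∀ M : Turing.TM2ComputableAux Bool Bool, ∃ (e : List Bool) (p : Polynomial ℕ),
      ∀ (w y : List Bool) (t : ℕ), M.OutputsWithin w y t → run (boolPair e w) (p.eval t) = some y) :
    IsDistNPComplete (univProblem run) :=
  ⟨univProblem_mem_DistNP run hrun, univProblem_isDistHard run hmono hsim⟩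

end DistNPComplete

/-! ### Main results -/

/-- **Existence of `DistNP`-complete problems, from clocked universal simulation.** If Mathlib's
`TM2` model carries a clocked universal machine in the sense of
`UniversalMachine.clockedUniversalSimulation` (Arora–Barak 2009, Thm. 1.9 / §1.4.1), then some
problem of `(NP, PSamp)` is complete for `DistNP` under deterministic heuristic polynomial-time
reductions: the bounded-acceptance language of the universal machine with its universal samplable
ensemble (`DistNPComplete.univProblem`). [BCGL 1992, §6, Thm. 9; Levin 1986; Bogdanov–Trevisan
2006, Thm. 3.3 / Ch. 5] [cite: BendavidEtAl1992, Theorem 9] -/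
theorem exists_isDistNPComplete_of_clockedUniversalSimulation
    (h : UniversalMachine.clockedUniversalSimulation) : exists_isDistNPComplete := by
  obtain ⟨run, hmono, hrun, hsim⟩ := h
  exact ⟨_, DistNPComplete.univProblem_isDistNPComplete run hmono hrun hsim⟩

/-- **Existence of `DistNP`-complete problems, given a universal machine** `U : UniversalMachine`
(the hypothesis structure of `UniversalMachine.lean`, equivalent to `clockedUniversalSimulation`
by `UniversalMachine.nonempty_iff_clockedUniversalSimulation`). [BCGL 1992, §6, Thm. 9; Levin 1986]
[cite: BendavidEtAl1992, Theorem 9] -/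
theorem exists_isDistNPComplete_of_universalMachine (U : UniversalMachine) :
    exists_isDistNPComplete :=
  exists_isDistNPComplete_of_clockedUniversalSimulation
    (UniversalMachine.clockedUniversalSimulation_of_nonempty ⟨U⟩)

/-- **Existence of `DistNP`-complete problems** — discharge of the named fact
`exists_isDistNPComplete`: the universal-machine hypothesis of
`exists_isDistNPComplete_of_clockedUniversalSimulation` is the tree's theorem
`ClockedUS.clockedUniversalSimulation_holds'` (`Complexity/ClockedUniversalSimulationProofs.lean`;
Arora–Barak 2009, Thm. 1.9 / §1.4.1 over Mathlib's `Turing.FinTM2`), whose statement is verbatim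
the body of `UniversalMachine.clockedUniversalSimulation`.
[BCGL 1992, §6, Thm. 9; Levin 1986; Bogdanov–Trevisan 2006, Thm. 3.3 / Ch. 5]
[cite: BendavidEtAl1992, Theorem 9] -/
theorem exists_isDistNPComplete_holds : exists_isDistNPComplete :=
  exists_isDistNPComplete_of_clockedUniversalSimulation ClockedUS.clockedUniversalSimulation_holds'

end Literature.Computability.MetaComplexity
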